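import Mathlib
import Summits.NavierStokesRegularity.NavierStokesRegularity.Theorems.LandauTailLandauTailBlowupEngine
import Summits.NavierStokesRegularity.NavierStokesRegularity.Theorems.LandauTailLandauTailBlowupMomentumBalance
import Summits.NavierStokesRegularity.NavierStokesRegularity.Theorems.LandauTailLandauTailBlowupShellFlux

/-!
# Crux `LandauTail.LandauTailBlowup` (stmt-NavierStokesRegularity-1944), line `registered`, cycle c7:
  stub `landauTail_momentum_law` — the EXACT LOCAL MOMENTUM LAW

Helper file on the proof path of the crux item `stmt-NavierStokesRegularity-1944`
(`Summit.NavierStokesRegularity.NavierStokesRegularity.Theses.LandauTail.LandauTailBlowup`), lead c7: the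
registered support stub `landauTail_momentum_law` (L1), composed from the worker stubs W2
(`landauTail_momentum_hasDerivAt`, p172779) and W3 (`landauTail_shell_flux_estimate`, p172983), Landau's flux
identity (`landauTail_flux_identity`, `landauTail_landau_flux_eq`, `landauTail_landau_flux_integral`) and Šverák's
normal form (`landauTail_exists_axis_of_profile`).

THEOREM. For a nonzero steady `(−1)`-homogeneous Navier–Stokes profile `(U, P)` smooth off the origin (a Landau
solution `landauAxisField a A`, Šverák 2011) there are the Landau axis `a` (`‖a‖ = 1`), Landau's force
`β = 2π β(A) > 0` and the envelope constant `L` of `U` (`|U(x)| ≤ L/|x|`) such that for EVERY classical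
unit-viscosity flow `(v, q)` on `ℝ³ × (−1, 0)` and every smooth solenoidal PLATEAU test `φ` (supported in `B_ρ`,
`φ = a`, `Dφ = 0`, `Δφ = 0` on `B̄_{ρ/2}`, `‖Dφ‖ ≤ K/ρ`, `|Δφ| ≤ K/ρ²`) the local momentum
`M(t) = ∫ ⟪v(t), φ⟫` is differentiable on `(−1, 0)` with CONTINUOUS derivative `F(t) = ∫ (⟪v,(v·∇)φ⟫ + ⟪v,Δφ⟫)`
and

  `|F(t) + β| ≤ (K/ρ²)(1 + 4L) ∫_{ρ/2<|y|<ρ} |v(t) − U| + (K/ρ) ∫_{ρ/2<|y|<ρ} |v(t) − U|²`: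

`M′ = −β` up to an error supported on the SHELL only. The plateau kills every error term inside `B_{ρ/2}`:
momentum enters the books solely through Landau's point force `β a δ₀` (STRATEGY-CENSUS §F3/F4 of the crux,
there a heuristic under `C¹` convergence with pressure; here exact, pointwise in time, pressure-free).

PROOF. W2 gives `M′(t) = F(t)` and the continuity of `F`; Landau's flux identity gives
`∫ (⟪U,(U·∇)φ⟫ + ⟪U,Δφ⟫) = −⟪φ(0), 2πβ(A) a⟩ = −β` (`φ(0) = a`); W3 bounds `|F(t) − F_U|` by the shell integrals.

References: L. D. Landau 1944; P. G. Lemarié-Rieusset 2016, Thm 10.13 / (10.48); V. Šverák 2011 (arXiv:math/0604550);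
G. K. Batchelor 1967, §4.6 (momentum flux of the point-force jet).
-/

set_option linter.dupNamespace false

noncomputable section

open Filter Set Topology MeasureTheory Metric Function
open scoped ENNReal NNReal InnerProductSpace RealInnerProductSpace Laplacian ContDiff
open Literature.Analysis.FluidPDE

namespace Summit.NavierStokesRegularity.NavierStokesRegularity.Theorems

/-- **L1 — the EXACT LOCAL MOMENTUM LAW** (registered support stub of crux stmt-NavierStokesRegularity-1944, lead c7;
Landau 1944, Lemarié-Rieusset 2016 (10.48), Batchelor 1967 §4.6): for a nonzero steady `(−1)`-homogeneous profile
`(U, P)` smooth off the origin there are a unit vector `a` (the Landau axis), `β > 0` (`= 2π β(A)`, Landau's force)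
and `L ≥ 0` (the envelope constant of `U`) such that for EVERY classical unit-viscosity flow `(v, q)` on
`ℝ³ × (−1,0)` and every plateau test `φ` of radius `ρ` with value `a` on `B̄_{ρ/2}`, `M(t) = ∫⟪v(t), φ⟫` has the
continuous derivative `F(t) = ∫ (⟪v,(v·∇)φ⟫ + ⟪v,Δφ⟫)` on `(−1,0)` and
`|F(t) + β| ≤ (K/ρ²)(1 + 4L)‖v(t) − U‖_{L¹(shell)} + (K/ρ)‖v(t) − U‖²_{L²(shell)}`. [folklore] -/
theorem landauTail_momentum_law : ∀ (U : EuclideanSpace ℝ (Fin 3) → EuclideanSpace ℝ (Fin 3)) (P : EuclideanSpace ℝ (Fin 3) → ℝ), (ContDiffOn ℝ (⊤ : ℕ∞) U {0}ᶜ ∧ ContDiffOn ℝ (⊤ : ℕ∞) P {0}ᶜ ∧ (∀ x : EuclideanSpace ℝ (Fin 3), x ≠ 0 → Literature.Analysis.FluidPDE.convect U U x + gradient P x = (1 : ℝ) • Laplacian.laplacian U x) ∧ (∀ x : EuclideanSpace ℝ (Fin 3), x ≠ 0 → Literature.Analysis.FluidPDE.VectorCalculus.divergence U x = 0) ∧ (∀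 c : ℝ, 0 < c → ∀ x : EuclideanSpace ℝ (Fin 3), U (c • x) = c⁻¹ • U x) ∧ (∃ x : EuclideanSpace ℝ (Fin 3), U x ≠ 0)) → ∃ a : EuclideanSpace ℝ (Fin 3), ‖a‖ = 1 ∧ ∃ β : ℝ, 0 < β ∧ ∃ L : ℝ, 0 ≤ L ∧ ∀ (v : ℝ → EuclideanSpace ℝ (Fin 3) → EuclideanSpace ℝ (Fin 3)) (q : ℝ → EuclideanSpace ℝ (Fin 3) → ℝ), Literature.Analysis.FluidPDE.IsClassicalNSSolutionOn (Set.Ioo (-1) 0) 1 0 v q → ∀ (ρ K : ℝ) (φ : EuclideanSpace ℝ (Fin 3) → EuclideanSpace ℝ (Fin 3)), 0 < ρ → 0 ≤ K → ContDiff ℝ (⊤ : ℕ∞) φ → tsupport φ ⊆ Metric.ball (0 : EuclideanSpace ℝ (Fin 3)) ρ → (∀ x, Literature.Analysis.FluidPDE.VectorCalculus.divergence φ x = 0) → (∀ x ∈ Metric.closedBall (0 : EuclideanSpace ℝ (Fin 3)) (ρ / 2), φ x = a) → (∀ x ∈ Metric.closedBall (0 : EuclideanSpace ℝ (Fin 3))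 (ρ / 2), fderiv ℝ φ x = 0) → (∀ x ∈ Metric.closedBall (0 : EuclideanSpace ℝ (Fin 3)) (ρ / 2), Laplacian.laplacian φ x = 0) → (∀ x, ‖fderiv ℝ φ x‖ ≤ K / ρ) → (∀ x, ‖Laplacian.laplacian φ x‖ ≤ K / ρ ^ 2) → (∀ t ∈ Set.Ioo (-1 : ℝ) 0, HasDerivAt (fun s : ℝ => ∫ x, inner ℝ (v s x) (φ x)) (∫ x, (inner ℝ (v t x) (Literature.Analysis.FluidPDE.convect (v t) φ x) + inner ℝ (v t x) (Laplacian.laplacian φ x))) t) ∧ ContinuousOn (fun t : ℝ => ∫ x, (inner ℝ (v t x) (Literature.Analysis.FluidPDE.convect (v t) φ x) + inner ℝ (v t x) (Laplacian.laplacian φ x))) (Set.Ioo (-1 : ℝ) 0) ∧ ∀ t ∈ Set.Ioo (-1 : ℝ) 0, |(∫ x, (inner ℝ (v t x) (Literature.Analysis.FluidPDE.convect (v t) φ x) + inner ℝ (v t x) (Laplacian.laplacian φ x))) + β| ≤ K / ρ ^ 2 * (1 + 4 * L) * (∫ x in Metric.ball (0 : EuclideanSpace ℝ (Fin 3)) ρ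 \ Metric.closedBall (0 : EuclideanSpace ℝ (Fin 3)) (ρ / 2), ‖v t x - U x‖) + K / ρ * (∫ x in Metric.ball (0 : EuclideanSpace ℝ (Fin 3)) ρ \ Metric.closedBall (0 : EuclideanSpace ℝ (Fin 3)) (ρ / 2), ‖v t x - U x‖ ^ 2) := by
  intro U P hprof
  obtain ⟨hUs, hPs, hNS, hdiv, hhom, hne⟩ := hprof
  have hUc : ContinuousOn U {0}ᶜ := hUs.continuousOn
  -- Šverák's normal form, Landau's flux constant, the envelope constant
  obtain ⟨a, ha, A, hA, hUeq⟩ := landauTail_exists_axis_of_profile one_pos hUs hPs hNS hdiv hhom hne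
  set β₀ : ℝ := 8 * A / 3 * (3 * A ^ 2 + 1) / (A ^ 2 - 1) - 4 * A ^ 2 * Real.log ((A + 1) / (A - 1))
    with hβ₀_def
  have hβ₀ : 0 < β₀ := landauTail_landau_flux_pos A hA
  obtain ⟨L, hL0, hLenv⟩ := landauTail_profile_norm_le hUc hhom
  have hLenv' : ∀ x : EuclideanSpace ℝ (Fin 3), x ≠ 0 → ‖U x‖ ≤ L / ‖x‖ := by
    intro x hx
    have h := hLenv x hx
    rwa [Real.rpow_neg_one, ← div_eq_mul_inv] at h
  refine ⟨a, ha, 2 * Real.pi * β₀, by positivity, L, hL0, ?_⟩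
  intro v q hcl ρ K φ hρ hK hφs hφsupp hφdiv hφa hφD0 hφΔ0 hφD hφΔ
  have hφc : HasCompactSupport φ :=
    HasCompactSupport.of_support_subset_isCompact (isCompact_closedBall (0 : EuclideanSpace ℝ (Fin 3)) ρ)
      ((subset_tsupport φ).trans (hφsupp.trans ball_subset_closedBall))
  obtain ⟨hder, hcont⟩ := landauTail_momentum_hasDerivAt v q φ hcl hφs hφc hφdiv
  refine ⟨hder, hcont, fun t ht => ?_⟩
  -- the value of the flux functional of `U`: Landau's point force
  have hφ0 : φ 0 = a := hφa 0 (mem_closedBall_self (by positivity))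
  have hval : ∫ x, (⟪U x, convect U φ x⟫ + ⟪U x, Δ φ x⟫) = -(2 * Real.pi * β₀) := by
    obtain ⟨hV, hPV, hNSV, hdivV, hhomV, -⟩ := landauTail_landauAxisField_profile ha hA
    have hflux := landauTail_flux_identity (landauAxisField a A) (landauAxisPressure a A) φ hV hPV hNSV
      hdivV hhomV (fun c hc x => landauAxisPressure_smul a A hc x) hφs hφc hφdiv
    rw [hφ0, landauTail_landau_flux_eq a A ha hA, landauTail_landau_flux_integral A hA] at hflux
    have hJV : ∫ x, (⟪U x, convect U φ x⟫ + ⟪U x, Δ φ x⟫) =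
        ∫ x, (⟪landauAxisField a A x, convect (landauAxisField a A) φ x⟫ +
          ⟪landauAxisField a A x, Δ φ x⟫) := by
      refine integral_congr_ae ?_
      filter_upwards [compl_mem_ae_iff.2 (measure_singleton (0 : EuclideanSpace ℝ (Fin 3)))] with x hx
      simp only [convect, hUeq x hx, one_smul]
    rw [hJV, hflux]
  -- the shell estimate for the slice `v t`
  have hVt : ContDiff ℝ 1 (v t) := (hcl.contDiff_velocity ht).of_le (by exact_mod_cast le_top)
  have hφ2 : ContDiff ℝ 2 φ := contDiff_infty.1 hφs 2
  have hW3 := landauTail_shell_flux_estimate (v t) U φ ρ K L hρ hK hL0 hVt hUc hLenv' hφ2 hφsupp hφD0 hφΔ0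
    hφD hφΔ
  rw [hval, sub_neg_eq_add] at hW3
  exact hW3

end Summit.NavierStokesRegularity.NavierStokesRegularity.Theorems

end
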